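import Literature.NumberTheory.DiophantineGeometry.GenEllDeCriticalLocusFamily
import Literature.NumberTheory.DiophantineGeometry.GenEllDeCriticalValues
import Mathlib.FieldTheory.IntermediateField.Adjoin.Basic
import Mathlib.FieldTheory.IntermediateField.Algebraic
import Mathlib.FieldTheory.Minpoly.Field
import Mathlib.RingTheory.Algebraic.Integral
import Mathlib.Analysis.Complex.Basic
import HarnessLib

/-!
# The critical values of the family `t_c` on the cover `D_e : r^e = x(1−x)`: algebraicity, the
# `Finset ℂ` of critical values, and a rational polynomial cutting them out
# (GenEllTwo, support piece W5c/CRIT for the family of S6's ruling #6)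

S. Mochizuki, *Arithmetic elliptic curves in general position*, Math. J. Okayama Univ. **52** (2010)
[cite: MochizukiGenEll2010, Thm 2.1 p.12], proof of Thm. 2.1 (ii) ⇒ (i), kurims pp. 12–13: the
noncritical Belyi map is built from a Belyi map on `ℙ¹` sending the CRITICAL VALUES of an auxiliary
function to `{0, 1, ∞}`.  In the abc-iut cell's number-field-only rendering for
`(X, D) = (ℙ¹, [0]+[1]+[∞])` (abc-iut-S6, `GENELLTWO-P1ROUTE.md`; route item
`Summit.ABC.ABC.Theses.IUTThetaPilot.GenEllTwo`), OWNER RULING #6 + AMENDMENT replaced the single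
function `t` by the FAMILY `t_c = 1/r + c·r^{k+1}/s = ((1 − 2x) + c·r^{k+2})/(r·(1 − 2x))`
(`c ∈ ℚ^×`, `s = 1 − 2x`, `e = 2k+1`), whose affine ramification locus is cut out by
`N_c = −s³ + c·((k+1)r^{k+2} − 2r^{3k+3})` (`DeCrit.NvalC`) and described in closed form by the
polynomial `R_c = c²α² − β³` (`DeCrit.RpolyC`, `DeCrit.zeroSetC_eq`: the zeros are the points
`(critXC c θ, θ)`, `R_c(θ) = 0`) of `GenEllDeCriticalLocusFamily.lean`.  This file is the
`c`-parametric twin of `GenEllDeCriticalValues.lean` (the case `c = 1`, whose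
`DeArch.cast_two_mul_add_one_ne_zero` is reused), in the `DeCrit` vocabulary:

* `DeCrit.tC k c x r` — the member `t_c` in the coordinates `(x, r)` (the expression of
  `De.fibreC_iff_t`; `map_tC`); `DeCrit.tCritC k c θ` — its value at the zero of `N_c` above a root
  `θ` of `R_c`, a rational function of `(c, θ)` (`tC_eq_tCritC`, `tC_critPointC`);
* NON-DEGENERACY `snd_ne_zero_and_one_sub_two_mul_ne_zero_of_NvalC` (zeros of `N_c` are not poles);
* ALGEBRAICITY for `c ∈ ℚ`: `isIntegral_of_eval_RpolyC` (roots of `R_c` are algebraic over `ℚ`),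
  `tCritC_mem_adjoin` (`tCritC c θ ∈ ℚ⟮θ⟯`), `isIntegral_tCritC`, `isIntegral_tC_of_NvalC_eq_zero`;
* `DeCrit.critSetC k c : Finset ℂ` (`c : ℚ`; the values `tCritC c θ` over the complex roots of
  `R_c`; ⊇ the critical values of `t_c` on the affine curve), `mem_critSetC_iff`, `card_critSetC_le`
  (`≤ 6k + 6 = 3e + 3`), `tC_mem_critSetC_of_NvalC_eq_zero`, `isAlgebraic_of_mem_critSetC` (= the
  Belyi package's hypothesis `hA` for `A := critSetC k c`), `isIntegral_of_mem_critSetC`;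
* `DeCrit.critPolyC k c : ℚ[X]` (product of the minimal polynomials of the elements of `critSetC`),
  `critPolyC_ne_zero`, `aeval_tC_critPolyC_eq_zero` (over `ℂ`),
  `aeval_tC_critPolyC_eq_zero_of_ringHom` (over any field embedding in `ℂ`), and the set forms
  `zeroSetC_subset_preimage_of_dvd` / `zeroSetC_subset_preimage_of_forall`: the zeros of `N_c` on
  `D_e(ℂ)` lie in `{P | m(t_c(P)) = 0}` for every `m ∈ ℚ[X]` divisible by `critPolyC k c`, resp.
  vanishing on `critSetC k c` ("`R_{t_c} ⊆ t_c⁻¹(B)`" once `B ⊇` roots of `critPolyC`) — the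
  hypothesis "critical values ⊆ `B`" of the good-prime packages for the member `t_c`;
* `forall_root_tC_mem_preimage_of_critSetC_subset` / `forall_root_tC_mem_of_critSetC_subset_image`
  (appended): TRANSPORT of "critical values ⊆ `B`" from `ℂ` to any field `L` with `σ : L →+* ℂ`
  (the `hcrit`/`hcritB` hypotheses of the converse junctions over number fields);
* `separatedC_of_x_separated`: `x`-separation from the finite set `{critXC c θ | R_c(θ) = 0}`
  implies (sup-distance) separation from every zero of `N_c` — the shape in which the archimedean /
  `p`-adic lower bounds for `N_c` are consumed by the spines.

Everything is proved; definitions `tC`, `tCritC`, `critSetC`, `critPolyC`; no named facts.  Classical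
and undisputed; nothing here refers to the disputed parts of the abc-iut corpus.  Deliberately NOT
here: that `critSetC` is EXACTLY the set of critical values (a superset suffices downstream), the
local multiplicity `ord_Q N_c = e_Q(t_c) − 1`, anything `2`-adic, any lower bound for `‖N_c‖`.
-/

noncomputable section

open Polynomial

namespace Literature.NumberTheory.DiophantineGeometry.GenEll

namespace DeCrit

/-! ### The function `t_c` and its value on the critical locus -/

section Basic

variable {F : Type*} [Field F] {k : ℕ}

/-- The member `t_c = 1/r + c·r^{k+1}/s = ((1 − 2x) + c·r^{k+2})/(r·(1 − 2x))` of the family on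
`D_e`, `s = 1 − 2x`, `e = 2k+1` (ruling #6: simple poles exactly at the three special points and the
Weierstrass points, for `c ≠ 0`; the expression is the one of `De.fibreC_iff_t`).
[cite: MochizukiGenEll2010, Thm 2.1 p.12] -/
def tC (k : ℕ) (c x r : F) : F := ((1 - 2 * x) + c * r ^ (k + 2)) / (r * (1 - 2 * x))

/-- `t_c` commutes with field homomorphisms (`c ↦ f c`). [cite: MochizukiGenEll2010, Thm 2.1 p.12] -/
theorem map_tC {E : Type*} [Field E] (f : F →+* E) (k : ℕ) (c x r : F) :
    f (tC k c x r) = tC k (f c) (f x) (f r) := by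
  simp [tC, map_div₀, map_add, map_sub, map_mul, map_pow, map_ofNat]

/-- The value of `t_c` at the zero of `N_c` above a root `θ` of `R_c`: with `s_θ = c·α(θ)/β(θ)`
(`DeCrit.critSC`), `t_c = (s_θ + c·θ^{k+2})/(θ·s_θ)` — a rational function of `(c, θ)`.
[cite: MochizukiGenEll2010, Thm 2.1 p.12] -/
def tCritC (k : ℕ) (c θ : F) : F := (critSC k c θ + c * θ ^ (k + 2)) / (θ * critSC k c θ)

/-- `tCritC` commutes with field homomorphisms. [cite: MochizukiGenEll2010, Thm 2.1 p.12] -/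
theorem map_tCritC {E : Type*} [Field E] (f : F →+* E) (k : ℕ) (c θ : F) :
    f (tCritC k c θ) = tCritC k (f c) (f θ) := by
  simp [tCritC, critSC, map_alpha, map_beta, map_div₀, map_add, map_mul, map_pow]

/-- The value of `t_c` at the critical point `Q_θ = (critXC c θ, θ)` is `tCritC c θ` (`2 ≠ 0`).
[cite: MochizukiGenEll2010, Thm 2.1 p.12] -/
theorem tC_critPointC (h2 : (2 : F) ≠ 0) (c θ : F) :
    tC k c (critXC k c θ) θ = tCritC k c θ := by
  unfold tC tCritC
  rw [one_sub_two_mul_critXC k h2]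

variable [CharZero F]

/-- On a zero of `N_c` on `D_e` (`c ≠ 0`): `1 − 2x = s_r` (`DeCrit.critSC`).
[cite: MochizukiGenEll2010, Thm 2.1 p.12] -/
theorem one_sub_two_mul_eq_critSC {c : F} (hc : c ≠ 0) {P : F × F}
    (hP : P.2 ^ (2 * k + 1) = P.1 * (1 - P.1)) (hN : NvalC k c P = 0) :
    1 - 2 * P.1 = critSC k c P.2 := by
  have hx := fst_eq_critXC_of_NvalC_eq_zero k (two_ne_zero : (2 : F) ≠ 0)
    (DeArch.cast_two_mul_add_one_ne_zero k) hc hP hN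
  rw [hx, one_sub_two_mul_critXC k (two_ne_zero : (2 : F) ≠ 0)]

/-- NON-DEGENERACY: a zero of `N_c` on `D_e` (`c ≠ 0`) has `r ≠ 0` and `s = 1 − 2x ≠ 0` — it is not
a pole of `t_c`. [cite: MochizukiGenEll2010, Thm 2.1 p.12] -/
theorem snd_ne_zero_and_one_sub_two_mul_ne_zero_of_NvalC {c : F} (hc : c ≠ 0) {P : F × F}
    (hP : P.2 ^ (2 * k + 1) = P.1 * (1 - P.1)) (hN : NvalC k c P = 0) :
    P.2 ≠ 0 ∧ 1 - 2 * P.1 ≠ 0 := by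
  have hR := eval_RpolyC_eq_zero_of_NvalC_eq_zero k c hP hN
  refine ⟨rootC_ne_zero k c hR, ?_⟩
  rw [one_sub_two_mul_eq_critSC hc hP hN, critSC]
  exact div_ne_zero (mul_ne_zero hc (alpha_ne_zero_of_rootC k (DeArch.cast_two_mul_add_one_ne_zero k) hc hR))
    (beta_ne_zero_of_rootC k (DeArch.cast_two_mul_add_one_ne_zero k) hc hR)

/-- On a zero of `N_c` on `D_e` (`c ≠ 0`), `t_c(P) = tCritC c r`. [cite: MochizukiGenEll2010, Thm 2.1 p.12] -/
theorem tC_eq_tCritC {c : F} (hc : c ≠ 0) {P : F × F} (hP : P.2 ^ (2 * k + 1) = P.1 * (1 - P.1))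
    (hN : NvalC k c P = 0) : tC k c P.1 P.2 = tCritC k c P.2 := by
  unfold tC tCritC
  rw [one_sub_two_mul_eq_critSC hc hP hN]

end Basic

/-! ### Algebraicity (rational parameter `c`) -/

section Algebraic

open IntermediateField

variable {F : Type*} [Field F] [CharZero F] {k : ℕ}

/-- For `c ∈ ℚ`, the rational polynomial `R_c ∈ ℚ[X]` evaluated in `F` is the polynomial `R_c` of
`F` (with `c` read in `F`). [cite: MochizukiGenEll2010, Thm 2.1 p.12] -/
theorem aeval_RpolyC_ratCast (c : ℚ) (θ : F) :
    aeval θ (RpolyC k c) = (RpolyC k (c : F)).eval θ := by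
  rw [← eval_map_algebraMap, map_RpolyC, eq_ratCast]

/-- A root of `R_c` (`c ∈ ℚ`) is integral over `ℚ` (`R_c ≠ 0`). [cite: MochizukiGenEll2010, Thm 2.1 p.12] -/
theorem isIntegral_of_eval_RpolyC {c : ℚ} {θ : F} (hθ : (RpolyC k (c : F)).eval θ = 0) :
    IsIntegral ℚ θ := by
  have hev : aeval θ (RpolyC k c) = 0 := by rw [aeval_RpolyC_ratCast]; exact hθ
  exact (show IsAlgebraic ℚ θ from ⟨_, RpolyC_ne_zero k c, hev⟩).isIntegral

/-- `tCritC c θ ∈ ℚ⟮θ⟯` for `c ∈ ℚ`. [cite: MochizukiGenEll2010, Thm 2.1 p.12] -/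
theorem tCritC_mem_adjoin (k : ℕ) (c : ℚ) (θ : F) : tCritC k (c : F) θ ∈ ℚ⟮θ⟯ := by
  have hθ : θ ∈ ℚ⟮θ⟯ := mem_adjoin_simple_self ℚ θ
  have hc : ((c : ℚ) : F) ∈ ℚ⟮θ⟯ := by
    have h := IntermediateField.algebraMap_mem ℚ⟮θ⟯ c
    rwa [eq_ratCast] at h
  have hs : critSC k (c : F) θ ∈ ℚ⟮θ⟯ := by
    unfold critSC alpha beta
    exact div_mem
      (mul_mem hc (sub_mem (mul_mem (add_mem (IntermediateField.natCast_mem _ k) (one_mem _))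
        (pow_mem hθ _)) (mul_mem (ofNat_mem _ 2) (pow_mem hθ _))))
      (sub_mem (one_mem _) (mul_mem (ofNat_mem _ 4) (pow_mem hθ _)))
  unfold tCritC
  exact div_mem (add_mem hs (mul_mem hc (pow_mem hθ _))) (mul_mem hθ hs)

/-- For a root `θ` of `R_c` (`c ∈ ℚ`), `tCritC c θ` is integral over `ℚ` (it lies in the finite
extension `ℚ⟮θ⟯`). [cite: MochizukiGenEll2010, Thm 2.1 p.12] -/
theorem isIntegral_tCritC {c : ℚ} {θ : F} (hθ : (RpolyC k (c : F)).eval θ = 0) :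
    IsIntegral ℚ (tCritC k (c : F) θ) := by
  haveI : FiniteDimensional ℚ ℚ⟮θ⟯ := adjoin.finiteDimensional (isIntegral_of_eval_RpolyC hθ)
  have h : IsIntegral ℚ (⟨tCritC k (c : F) θ, tCritC_mem_adjoin k c θ⟩ : ℚ⟮θ⟯) :=
    IsIntegral.of_finite ℚ _
  exact isIntegral_iff.mp h

/-- ALGEBRAICITY: the value `t_c(P)` at a zero of `N_c` on `D_e(F)` (`c ∈ ℚ^×`) is integral
(algebraic) over `ℚ`. [cite: MochizukiGenEll2010, Thm 2.1 p.12] -/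
theorem isIntegral_tC_of_NvalC_eq_zero {c : ℚ} (hc : c ≠ 0) {P : F × F}
    (hP : P.2 ^ (2 * k + 1) = P.1 * (1 - P.1)) (hN : NvalC k (c : F) P = 0) :
    IsIntegral ℚ (tC k (c : F) P.1 P.2) := by
  have hcF : (c : F) ≠ 0 := Rat.cast_ne_zero.mpr hc
  rw [tC_eq_tCritC hcF hP hN]
  exact isIntegral_tCritC (eval_RpolyC_eq_zero_of_NvalC_eq_zero k (c : F) hP hN)

end Algebraic

/-! ### The critical-value set and polynomial of the member `t_c`, `c ∈ ℚ` -/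

section Crit

variable {k : ℕ}

/-- THE CRITICAL-VALUE SET of `t_c` on `D_e` (⊇ `t_c`(affine ramification points), which are the
zeros of `N_c`): the values `tCritC c θ` over the complex roots `θ` of `R_c`, a `Finset ℂ`.
[cite: MochizukiGenEll2010, Thm 2.1 p.12] -/
def critSetC (k : ℕ) (c : ℚ) : Finset ℂ :=
  ((RpolyC k c).aroots ℂ).toFinset.image (tCritC k (c : ℂ))

/-- Membership in `critSetC`. [cite: MochizukiGenEll2010, Thm 2.1 p.12] -/
theorem mem_critSetC_iff {c : ℚ} {a : ℂ} :
    a ∈ critSetC k c ↔ ∃ θ : ℂ, (RpolyC k (c : ℂ)).eval θ = 0 ∧ tCritC k (c : ℂ) θ = a := by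
  constructor
  · intro ha
    obtain ⟨θ, hθ, hθa⟩ := Finset.mem_image.mp ha
    refine ⟨θ, ?_, hθa⟩
    rw [← aeval_RpolyC_ratCast]
    exact (mem_aroots'.mp (Multiset.mem_toFinset.mp hθ)).2
  · rintro ⟨θ, hθ, hθa⟩
    refine Finset.mem_image.mpr ⟨θ, Multiset.mem_toFinset.mpr (mem_aroots'.mpr ⟨?_, ?_⟩), hθa⟩
    · rw [map_RpolyC]; exact RpolyC_ne_zero k _
    · rw [aeval_RpolyC_ratCast]; exact hθ

/-- `critSetC` has at most `6k + 6 = 3e + 3` elements (`= deg R_{t_c}`).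
[cite: MochizukiGenEll2010, Thm 2.1 p.12] -/
theorem card_critSetC_le (k : ℕ) (c : ℚ) : (critSetC k c).card ≤ 6 * k + 6 := by
  unfold critSetC
  refine Finset.card_image_le.trans ?_
  refine (Multiset.toFinset_card_le _).trans ?_
  refine (card_roots' _).trans ?_
  exact natDegree_map_le.trans (natDegree_RpolyC_le k c)

/-- Every zero of `N_c` on `D_e(ℂ)` (`c ∈ ℚ^×`) has its `t_c`-value in `critSetC`
("`R_{t_c} ⊆ t_c⁻¹(A_c)`"). [cite: MochizukiGenEll2010, Thm 2.1 p.12] -/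
theorem tC_mem_critSetC_of_NvalC_eq_zero {c : ℚ} (hc : c ≠ 0) {P : ℂ × ℂ}
    (hP : P.2 ^ (2 * k + 1) = P.1 * (1 - P.1)) (hN : NvalC k (c : ℂ) P = 0) :
    tC k (c : ℂ) P.1 P.2 ∈ critSetC k c :=
  mem_critSetC_iff.mpr ⟨P.2, eval_RpolyC_eq_zero_of_NvalC_eq_zero k (c : ℂ) hP hN,
    (tC_eq_tCritC (Rat.cast_ne_zero.mpr hc) hP hN).symm⟩

/-- Every element of `critSetC` is integral over `ℚ`. [cite: MochizukiGenEll2010, Thm 2.1 p.12] -/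
theorem isIntegral_of_mem_critSetC {c : ℚ} {a : ℂ} (ha : a ∈ critSetC k c) : IsIntegral ℚ a := by
  obtain ⟨θ, hθ, rfl⟩ := mem_critSetC_iff.mp ha
  exact isIntegral_tCritC hθ

/-- Every element of `critSetC` is algebraic over `ℚ` — the hypothesis `hA` of the noncritical Belyi
map package (`∀ a ∈ A, IsAlgebraic ℚ a`, with `A := critSetC k c`).
[cite: MochizukiGenEll2010, Thm 2.1 p.12] -/
theorem isAlgebraic_of_mem_critSetC {c : ℚ} {a : ℂ} (ha : a ∈ critSetC k c) : IsAlgebraic ℚ a :=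
  (isIntegral_of_mem_critSetC ha).isAlgebraic

/-- The critical points `Q_θ = (critXC c θ, θ)` have `t_c`-value `tCritC c θ ∈ critSetC` (over `ℂ`).
[cite: MochizukiGenEll2010, Thm 2.1 p.12] -/
theorem tC_critPointC_mem_critSetC {c : ℚ} {θ : ℂ} (hθ : (RpolyC k (c : ℂ)).eval θ = 0) :
    tC k (c : ℂ) (critPointC k (c : ℂ) θ).1 (critPointC k (c : ℂ) θ).2 ∈ critSetC k c := by
  rw [critPointC_fst, critPointC_snd, tC_critPointC two_ne_zero]
  exact mem_critSetC_iff.mpr ⟨θ, hθ, rfl⟩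

/-- THE CRITICAL-VALUE POLYNOMIAL of `t_c`: a nonzero rational polynomial vanishing on `critSetC`
(product of minimal polynomials). [cite: MochizukiGenEll2010, Thm 2.1 p.12] -/
def critPolyC (k : ℕ) (c : ℚ) : ℚ[X] := ∏ a ∈ critSetC k c, minpoly ℚ a

/-- `critPolyC ≠ 0`. [cite: MochizukiGenEll2010, Thm 2.1 p.12] -/
theorem critPolyC_ne_zero (k : ℕ) (c : ℚ) : critPolyC k c ≠ 0 :=
  Finset.prod_ne_zero_iff.mpr fun _ ha => minpoly.ne_zero (isIntegral_of_mem_critSetC ha)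

/-- `critPolyC` vanishes on `critSetC`. [cite: MochizukiGenEll2010, Thm 2.1 p.12] -/
theorem aeval_critPolyC_of_mem_critSetC {c : ℚ} {a : ℂ} (ha : a ∈ critSetC k c) :
    aeval a (critPolyC k c) = 0 := by
  rw [critPolyC, map_prod]
  exact Finset.prod_eq_zero ha (minpoly.aeval ℚ a)

/-- **CRITICAL VALUES ARE ROOTS OF `critPolyC`** (over `ℂ`): for every zero `P` of `N_c` on
`D_e(ℂ)`, `critPolyC(t_c(P)) = 0`. [cite: MochizukiGenEll2010, Thm 2.1 p.12] -/
theorem aeval_tC_critPolyC_eq_zero {c : ℚ} (hc : c ≠ 0) {P : ℂ × ℂ}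
    (hP : P.2 ^ (2 * k + 1) = P.1 * (1 - P.1)) (hN : NvalC k (c : ℂ) P = 0) :
    aeval (tC k (c : ℂ) P.1 P.2) (critPolyC k c) = 0 :=
  aeval_critPolyC_of_mem_critSetC (tC_mem_critSetC_of_NvalC_eq_zero hc hP hN)

/-- Transported form: for any field `F` with a homomorphism `ι : F →+* ℂ` (number fields, `ℚ̄`),
every zero `P` of `N_c` on `D_e(F)` has `critPolyC(t_c(P)) = 0`. [cite: MochizukiGenEll2010, Thm 2.1 p.12] -/
theorem aeval_tC_critPolyC_eq_zero_of_ringHom {F : Type*} [Field F] [CharZero F] (ι : F →+* ℂ)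
    {c : ℚ} (hc : c ≠ 0) {P : F × F} (hP : P.2 ^ (2 * k + 1) = P.1 * (1 - P.1))
    (hN : NvalC k (c : F) P = 0) : aeval (tC k (c : F) P.1 P.2) (critPolyC k c) = 0 := by
  have hP' : (ι P.2) ^ (2 * k + 1) = (ι P.1) * (1 - ι P.1) := by
    rw [← map_pow, hP, map_mul, map_sub, map_one]
  have hN' : NvalC k (c : ℂ) ((ι P.1, ι P.2) : ℂ × ℂ) = 0 := by
    have := map_NvalC ι k (c : F) P
    rw [hN, map_zero, map_ratCast] at this
    exact this.symm
  have h := aeval_tC_critPolyC_eq_zero hc hP' hN'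
  have hcomm : (algebraMap ℚ ℂ).comp (RingHom.id ℚ) = ι.comp (algebraMap ℚ F) :=
    Subsingleton.elim _ _
  have key := Polynomial.map_aeval_eq_aeval_map hcomm (critPolyC k c) (tC k (c : F) P.1 P.2)
  rw [Polynomial.map_id, map_tC, map_ratCast] at key
  rw [← key, map_eq_zero_iff ι ι.injective] at h
  exact h

/-- SET FORM ("`R_{t_c} ⊆ t_c⁻¹(B)`"): for every rational polynomial `m` divisible by `critPolyC`,
the zeros of `N_c` on `D_e(ℂ)` lie in `{P | m(t_c(P)) = 0}`. [cite: MochizukiGenEll2010, Thm 2.1 p.12] -/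
theorem zeroSetC_subset_preimage_of_dvd {c : ℚ} (hc : c ≠ 0) {m : ℚ[X]} (hm : critPolyC k c ∣ m) :
    {P : ℂ × ℂ | P.2 ^ (2 * k + 1) = P.1 * (1 - P.1) ∧ NvalC k (c : ℂ) P = 0} ⊆
      {P | aeval (tC k (c : ℂ) P.1 P.2) m = 0} := by
  rintro P ⟨hP, hN⟩
  obtain ⟨q, rfl⟩ := hm
  simp only [Set.mem_setOf_eq, map_mul, aeval_tC_critPolyC_eq_zero hc hP hN, zero_mul]

/-- SET FORM with a vanishing hypothesis instead of divisibility: if `m(a) = 0` for all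
`a ∈ critSetC k c` (the shape of the Belyi package's output with `A := critSetC k c`), then the zeros
of `N_c` on `D_e(ℂ)` lie in `{P | m(t_c(P)) = 0}`. [cite: MochizukiGenEll2010, Thm 2.1 p.12] -/
theorem zeroSetC_subset_preimage_of_forall {c : ℚ} (hc : c ≠ 0) {m : ℚ[X]}
    (hm : ∀ a ∈ critSetC k c, aeval a m = 0) :
    {P : ℂ × ℂ | P.2 ^ (2 * k + 1) = P.1 * (1 - P.1) ∧ NvalC k (c : ℂ) P = 0} ⊆
      {P | aeval (tC k (c : ℂ) P.1 P.2) m = 0} :=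
  fun _ hP => hm _ (tC_mem_critSetC_of_NvalC_eq_zero hc hP.1 hP.2)

/-- The "critical values ⊆ `B`" hypothesis of the good-prime reduction
(`DeCrit.exists_mem_valuation_tC_sub_lt_one`) holds over `ℂ` for every `B ⊇ critSetC k c` read as
values `t_c(Q_θ)`: for every complex root `θ` of `R_c`, `t_c(critXC c θ, θ) ∈ B`.
[cite: MochizukiGenEll2010, Thm 2.1 p.12] -/
theorem forall_root_tC_mem_of_critSetC_subset {c : ℚ} {B : Set ℂ} (hB : ↑(critSetC k c) ⊆ B) :
    ∀ θ : ℂ, (RpolyC k (c : ℂ)).eval θ = 0 →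
      ((1 - 2 * critXC k (c : ℂ) θ) + (c : ℂ) * θ ^ (k + 2)) / (θ * (1 - 2 * critXC k (c : ℂ) θ)) ∈ B :=
  fun _ hθ => hB (tC_critPointC_mem_critSetC hθ)

/-- TRANSPORT of "critical values ⊆ `B`" from `ℂ` to a field `L` embedded in `ℂ` (number fields):
if `σ : L →+* ℂ` and `B ⊆ ℂ` contains `critSetC k c`, then for every root `θ ∈ L` of `R_c` the value
`t_c(Q_θ) ∈ L` lies in `σ⁻¹(B)` — the `hcrit` hypothesis of
`DeCrit.exists_mem_valuation_tC_sub_lt_one'` for the set `σ⁻¹(B) ⊆ L`.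
[cite: MochizukiGenEll2010, Thm 2.1 p.12] -/
theorem forall_root_tC_mem_preimage_of_critSetC_subset {L : Type*} [Field L] [CharZero L]
    (σ : L →+* ℂ) {c : ℚ} {B : Set ℂ} (hB : ↑(critSetC k c) ⊆ B) :
    ∀ θ : L, (RpolyC k (c : L)).eval θ = 0 →
      ((1 - 2 * critXC k (c : L) θ) + (c : L) * θ ^ (k + 2)) / (θ * (1 - 2 * critXC k (c : L) θ)) ∈
        σ ⁻¹' B := by
  intro θ hθ
  have hθ' : (RpolyC k (c : ℂ)).eval (σ θ) = 0 := by
    have h := eval_RpolyC_map σ k (c : L) θ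
    rw [map_ratCast, hθ, map_zero] at h
    exact h
  have hmem := hB (tC_critPointC_mem_critSetC (k := k) hθ')
  rw [critPointC_fst, critPointC_snd] at hmem
  show σ _ ∈ B
  have e : σ (((1 - 2 * critXC k (c : L) θ) + (c : L) * θ ^ (k + 2)) /
      (θ * (1 - 2 * critXC k (c : L) θ))) = tC k (c : ℂ) (critXC k (c : ℂ) (σ θ)) (σ θ) := by
    rw [show ((1 - 2 * critXC k (c : L) θ) + (c : L) * θ ^ (k + 2)) /
        (θ * (1 - 2 * critXC k (c : L) θ)) = tC k (c : L) (critXC k (c : L) θ) θ from rfl,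
      map_tC, map_critXC, map_ratCast]
  rw [e]
  exact hmem

/-- The same transport into a `Finset` of `L`: if `σ(B) ⊇ critSetC k c` for a finite `B ⊆ L`, then
`t_c(Q_θ) ∈ B` for every root `θ ∈ L` of `R_c` (the `hcritB` shape of the converse junctions, with
`B : Finset L`). [cite: MochizukiGenEll2010, Thm 2.1 p.12] -/
theorem forall_root_tC_mem_of_critSetC_subset_image {L : Type*} [Field L] [CharZero L]
    (σ : L →+* ℂ) {c : ℚ} {B : Finset L} (hB : ↑(critSetC k c) ⊆ σ '' ↑B) :
    ∀ θ : L, (RpolyC k (c : L)).eval θ = 0 →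
      ((1 - 2 * critXC k (c : L) θ) + (c : L) * θ ^ (k + 2)) / (θ * (1 - 2 * critXC k (c : L) θ)) ∈
        B := by
  intro θ hθ
  have h := forall_root_tC_mem_preimage_of_critSetC_subset (k := k) σ hB θ hθ
  obtain ⟨b, hb, hbe⟩ := h
  rwa [← σ.injective hbe]

end Crit

/-! ### Separation in the `x`-coordinate only (the shape of the spines' hypothesis) -/

section XSeparation

variable {k : ℕ}

/-- The zeros of `N_c` on `D_e(ℂ)` (`c ≠ 0`) are the critical points `(critXC c θ, θ)`: a point whose
`x`-coordinate is `ρ`-far from every `critXC c θ` (`R_c(θ) = 0`) is `ρ`-far (sup-distance) from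
every zero of `N_c`. [cite: MochizukiGenEll2010, Thm 2.1 p.12] -/
theorem separatedC_of_x_separated {c : ℂ} (hc : c ≠ 0) {ρ : ℝ} {P : ℂ × ℂ}
    (hsep : ∀ θ : ℂ, (RpolyC k c).eval θ = 0 → ρ ≤ ‖P.1 - critXC k c θ‖) :
    ∀ Q : ℂ × ℂ, Q.2 ^ (2 * k + 1) = Q.1 * (1 - Q.1) → NvalC k c Q = 0 → ρ ≤ dist P Q := by
  intro Q hQ hN
  have hR := eval_RpolyC_eq_zero_of_NvalC_eq_zero k c hQ hN
  have hx : Q.1 = critXC k c Q.2 :=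
    fst_eq_critXC_of_NvalC_eq_zero k two_ne_zero (DeArch.cast_two_mul_add_one_ne_zero k) hc hQ hN
  calc ρ ≤ ‖P.1 - critXC k c Q.2‖ := hsep Q.2 hR
    _ = dist P.1 Q.1 := by rw [hx, dist_eq_norm]
    _ ≤ dist P Q := by rw [Prod.dist_eq]; exact le_max_left _ _

end XSeparation

end DeCrit

end Literature.NumberTheory.DiophantineGeometry.GenEll

end
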